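import Summits.HodgeConjecture.HodgeConjecture.Theorems.Ring2BindersAbelianSchemeVHCPrimitiveStep
import Summits.HodgeConjecture.HodgeConjecture.Theorems.Ring2BindersAbelianSchemeVHCMiddleLift
import Literature.AlgebraicTopology.SingularHomology.CohomologyOfPoint
import HarnessLib

/-!
# Ring 2 — binder seat b02 (Hodge ladder stage 3): the PRIMITIVE ONE-STEP LIFT `W ↦ L_{pr₁^*K}(pr₁^*W) - (r+1) · L_{pr₂^*K_E}(pr₁^*W)`
# on `𝒳 × E` (E an elliptic curve) for row b02 `AbelianSchemeVHC` — fibrewise Lefschetz-primitive, defect one less, same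
# algebraicity locus; fact-free

HONEST FRAMING: research route conditional on HC_CM; not a corollary; Q11.4-sentence-2 already refuted in dim ≥ 3.

Cell `pub-hodge-ring2`, binder seat `ring2-b02`, row b02 of `BINDER-OWNERS.md` (`Ring2.Hypotheses.AbelianSchemeVHC`,
`Theorems/Ring2Hypotheses.lean`: Grothendieck's variational Hodge conjecture, global-class form, along smooth projective
families all of whose complex fibres are abelian varieties; OPEN, print-equivalent to `HC_AV`, nothing to discharge).
`HC_CM` (`Theses.RankFourFaces.CMAbelianHodge`) does not occur below; nothing here is a case of the Hodge conjecture; no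
`sorry`, no definition, no NEW Literature fact, no node; «10 · 0» untouched.

WHAT THIS PART DOES. The middle-degree part (`Ring2BindersAbelianSchemeVHCMiddleDegree.lean`, p249658) sent row b02 to its
DIAGONAL cells `(2q, q)` (all fibrewise rational `(q,q)` classes of the middle degree) and the primitive part
(`Ring2BindersAbelianSchemeVHCPrimitive.lean`, p251474) to its fibrewise LEFSCHETZ-PRIMITIVE classes of codimension
`2 ≤ p ≤ n/2` (all defects `n - 2p ≥ 0`); their intersection — fibrewise-primitive classes of the MIDDLE degree, defect `0` —
was not reached, because the middle lift `pr^*(Kʳ ∪ W)` of a primitive class is not primitive. This file is the engine that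
closes the gap, one dimension at a time and WITHOUT leaving the class of abelian-fibred carriers (the classical reduction to
primitive middle classes, Kerr–Pearlstein §3.1 after Lefschetz, uses `X × ℙʳ` and hyperplane sections): for a class `x` of
degree `2p` on an `n`-fold, `n = 2p + (r + 1)`, PRIMITIVE for `κ₁` (`L_{κ₁}^{r+2} x = 0`), and a second class `κ₂` with
`κ₂ ∪ κ₂ = 0` (the polarisation of an elliptic curve `E`, pulled back to `X × E`), the class
`z := L_{κ₁} x - (r + 1) · L_{κ₂} x` of degree `2(p + 1)` satisfies `L_{κ₁+κ₂}^{r+1} z = L_{κ₁}^{r+2} x = 0`, i.e. `z` is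
PRIMITIVE for the exterior-sum polarisation `κ₁ + κ₂` of the `(n+1)`-fold `X × E`, with Lefschetz defect `r` — one less. In
`𝔰𝔩₂`-language: `x` spans the lowest weight of `V_{r+1}`, `H^•(E) ⊃ V_1`, and `z` is the lowest-weight vector of the summand
`V_r ⊂ V_{r+1} ⊗ V_1` (Clebsch–Gordan).

* §1 (formal, any space `Y`, classes `κ₁, κ₂ ∈ H²(Y; ℂ)`): `lefschetzOperator_comm` / `lefschetzOperator_lefschetzPowTo_comm`
  (`L₁`, `L₂` commute — graded commutativity in even degree) and **`lefschetzPowTo_primitiveLift`**: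
  `L_{κ₁+κ₂}ʲ (L₁ x - r · L₂ x) = L₁ʲ (L₁ x) + (j - r) · L₁ʲ (L₂ x)` whenever `κ₂ ∪ (κ₂ ∪ x) = 0`.
* §2 (one smooth projective `X` of dimension `n`, one abelian variety `E` of dimension `1`, `η ∈ H²(X)`, `K_E ∈ H²(E)`,
  `z = L_{pr₁^*η}(pr₁^*c) - (r + 1) · L_{pr₂^*K_E}(pr₁^*c)` on `X × E`): **`primitiveLift_mem_primitiveClasses`** (`c ∈ P^{2p}(X, η)`,
  `2p + (r + 1) = n` ⟹ `z ∈ P^{2(p+1)}(X × E, pr₁^*η + pr₂^*K_E)` in dimension `n + 1`; `(pr₂^*K_E)² = pr₂^*(K_E²) = 0` as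
  `H⁴(E(ℂ)) = 0`), `isRationalClass_primitiveLift`, `isOfHodgeType_primitiveLift` (type `(p+1, p+1)`: pull-backs preserve types,
  an algebraic degree-`2` class is of type `(1,1)`, `∪` adds types), `primitiveLift_mem_algebraicClasses` (`c` algebraic ⟹ `z`
  algebraic: flat `pr₁^*`, Lefschetz operators of divisor classes), and the abelian input
  **`mem_algebraicClasses_of_primitiveLift_mem`**: `z` algebraic ⟹ `c` algebraic when `X` is (isomorphic to) an abelian variety
  and `η` a polarisation — restrict `z` to the slice `X ≅ X × {t}`, a fibre of the CONSTANT family `X × E ⟶ E` where the tree's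
  specialisation theorem `map_fiberι_mem_algebraicClasses` applies; there `pr₂^*K_E` dies (`H²(Spec ℂ (ℂ)) = 0`,
  `complexBetti_specOver_eq_zero`), so `z|_{X × {t}} = L_η c` is algebraic, hence `L_η^{r+1} c` is, and `A(X, η)` — Lieberman —
  descends the hard-Lefschetz isomorphism `L_η^{r+1} : H^{2p} ⥲ H^{2n-2p}` (`mem_algebraicClasses_of_lefschetzPowTo_mem`).
The family form (on `pr_𝒳 ≫ f : 𝒳 × E ⟶ S`, with the exterior-sum polarisation `pr_𝒳^*K + pr_E^*K_E` of row b05's seat's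
`isPolarizationClass_boxSum`) and the induction on the defect are the sequel `Ring2BindersAbelianSchemeVHCPrimitiveMiddleFamily.lean`;
the binder-level statements (row b02 ⟺ its primitive-MIDDLE form modulo the print residual c20 / N97) are
`Ring2BindersAbelianSchemeVHCPrimitiveMiddle.lean`.

Everything is FACT-FREE (closures: the three standard axioms). What is NOT claimed: any case of `AbelianSchemeVHC` or of HC; anything about `HC_CM`; the single-variety normal form of `HC_AV`
by primitive middle classes (AbelianAll's parts XIV/XV are the single-variety statements of record; §2 would serve it verbatim).

References: [VoisinHodgeI2002] §6.2.3 Def. 6.24, Thm. 6.25, Cor. 6.26, Rem. 6.27, §7.1.2, §7.3.2, §11.1.2 Prop. 11.20;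
[VoisinHodgeII2003] §9.2.4 Prop. 9.20, proof of Prop. 9.21 (i); [Kleiman1968AlgebraicCycles] §1.4 (1.4.6), Thm. 2.9, Thm. 2A11;
[Andre1996Motifs] §1.1, §1.3; [Lieberman1968] main theorem; [KerrPearlstein2011] §3.1 (and Thm. 32); [BrosnanFangNiePearlstein2009]
§6 Lemma 48; [Fulton1998] §10.1 Cor. 10.1, Example 10.1.2, §19.2 Cor. 19.2; [CharlesSchnell2014Notes] Conj. 11.3.1, Prop. 11.3.11;
[HatcherAT2002] §3.1 p. 199, §3.2 pp. 206, 211, Prop. 3.10, Thm. 3.11, §3.3 Thm. 3.26(c); [Hartshorne1977] II.3 p. 89, III Prop. 10.1;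
[MumfordAV1970] §1.
-/

-- every declaration of this problem lives in `Summit.HodgeConjecture.HodgeConjecture.…` (summit = sub-problem);
-- namespace `…Ring2.Binders` = the binder seats of the cell's Hodge-ladder stage 3 (`BINDER-OWNERS.md`)
set_option linter.dupNamespace false

noncomputable section

open CategoryTheory CategoryTheory.Limits AlgebraicGeometry Topology MonoidalCategory CartesianMonoidalCategory
open Literature.AlgebraicGeometry Literature.AlgebraicGeometry.Motives
open Literature.AlgebraicGeometry.HodgeTheory
open Literature.AlgebraicTopology.SingularHomology (singularCohomology cupProduct cupProduct_assoc
  cupProduct_gradedComm_holds cupProduct_map)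
open Literature.Geometry.Kaehler (lefschetzOperator lefschetzOperator_apply lefschetzPow HasHardLefschetzProperty)

namespace Summit.HodgeConjecture.HodgeConjecture.Ring2.Binders

/-! ## §1 Two commuting Lefschetz operators, one of square zero: the `𝔰𝔩₂`-string of `L₁ x - r · L₂ x` (formal) -/

section Formal

variable {Y : Type} [TopologicalSpace Y] (κ₁ κ₂ : singularCohomology ℂ ℂ Y 2)

/-- The Lefschetz operator of a sum of classes is the sum of the Lefschetz operators (bilinearity of `∪`).
[cite: HatcherAT2002, §3.2 p. 206] -/
theorem lefschetzOperator_add {k l : ℕ} (h : 2 + k = l) (x : singularCohomology ℂ ℂ Y k) :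
    lefschetzOperator (κ₁ + κ₂) h x = lefschetzOperator κ₁ h x + lefschetzOperator κ₂ h x := by
  simp only [lefschetzOperator_apply, map_add, LinearMap.add_apply]

/-- Two Lefschetz operators commute: `L₂ (L₁ x) = L₁ (L₂ x)` (associativity and graded commutativity of `∪` in even
degree). [cite: HatcherAT2002, §3.2 p. 211 and Thm. 3.11] -/
theorem lefschetzOperator_comm {k l m : ℕ} (hl : 2 + k = l) (hm : 2 + l = m) (x : singularCohomology ℂ ℂ Y k) :
    lefschetzOperator κ₂ hm (lefschetzOperator κ₁ hl x) = lefschetzOperator κ₁ hm (lefschetzOperator κ₂ hl x) := by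
  rw [lefschetzOperator_apply κ₂ hm, lefschetzOperator_apply κ₂ hl]
  exact cupProduct_lefschetzOperator_right κ₁ hl hm hl hm κ₂ x

/-- Two Lefschetz operators commute past each other's iterates: `L₂ (L₁ʲ y) = L₁ʲ (L₂ y)`.
[cite: HatcherAT2002, §3.2 p. 211 and Thm. 3.11] -/
theorem lefschetzOperator_lefschetzPowTo_comm (j : ℕ) {k m m' l : ℕ} (hm : k + 2 * j = m) (hm' : 2 + m = m')
    (hl : 2 + k = l) (hl' : l + 2 * j = m') (y : singularCohomology ℂ ℂ Y k) :
    lefschetzOperator κ₂ hm' (lefschetzPowTo κ₁ j k m hm y) = lefschetzPowTo κ₁ j l m' hl' (lefschetzOperator κ₂ hl y) := by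
  rw [lefschetzOperator_apply, lefschetzOperator_apply]
  exact cupProduct_lefschetzPowTo_right κ₁ j hm hm' hl hl' κ₂ y

/-- **The `𝔰𝔩₂`-string of the primitive one-step lift (formal identity).** For classes `κ₁, κ₂ ∈ H²(Y)` and `x ∈ Hᵏ(Y)`
with `κ₂ ∪ (κ₂ ∪ x) = 0`, the class `z := L_{κ₁} x - r · L_{κ₂} x` satisfies, for every `j`,
`L_{κ₁+κ₂}ʲ z = L_{κ₁}ʲ (L_{κ₁} x) + (j - r) · L_{κ₁}ʲ (L_{κ₂} x)` — the binomial expansion of `(L₁ + L₂)ʲ (L₁ - r L₂)`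
with `L₂² = 0`, `L₁ L₂ = L₂ L₁`. At `j = r` the second term vanishes. [cite: Kleiman1968AlgebraicCycles, §1.4 (1.4.6)]
[cite: HatcherAT2002, §3.2 Thm. 3.11] -/
theorem lefschetzPowTo_primitiveLift {k l : ℕ} (hl : 2 + k = l) (x : singularCohomology ℂ ℂ Y k)
    (h0 : lefschetzOperator κ₂ (rfl : 2 + l = 2 + l) (lefschetzOperator κ₂ hl x) = 0) (r : ℕ) :
    ∀ (j : ℕ) {m : ℕ} (hm : l + 2 * j = m),
      lefschetzPowTo (κ₁ + κ₂) j l m hm (lefschetzOperator κ₁ hl x - (r : ℂ) • lefschetzOperator κ₂ hl x) =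
        lefschetzPowTo κ₁ j l m hm (lefschetzOperator κ₁ hl x) +
          ((j : ℂ) - r) • lefschetzPowTo κ₁ j l m hm (lefschetzOperator κ₂ hl x) := by
  intro j
  induction j with
  | zero =>
    intro m hm
    obtain rfl : m = l := by omega
    simp only [lefschetzPowTo_zero_apply]
    push_cast
    module
  | succ j ih =>
    intro m hm
    rw [lefschetzPowTo_succ_apply (κ₁ + κ₂) j l (l + 2 * j) m rfl hm (by omega), ih rfl, map_add, map_smul,
      lefschetzOperator_add, lefschetzOperator_add,
      -- `L₁ (L₁ʲ (L₁ x)) = L₁^{j+1} (L₁ x)`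
      ← lefschetzPowTo_succ_apply κ₁ j l (l + 2 * j) m rfl hm (by omega),
      -- `L₂ (L₁ʲ (L₁ x)) = L₁ʲ (L₂ (L₁ x)) = L₁ʲ (L₁ (L₂ x)) = L₁^{j+1} (L₂ x)`
      lefschetzOperator_lefschetzPowTo_comm κ₁ κ₂ j (rfl : l + 2 * j = l + 2 * j) (by omega) rfl (by omega),
      lefschetzOperator_comm κ₁ κ₂ hl rfl x,
      lefschetzPowTo_lefschetzOperator κ₁ j (rfl : 2 + l = 2 + l) (by omega) hm,
      -- `L₁ (L₁ʲ (L₂ x)) = L₁^{j+1} (L₂ x)`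
      ← lefschetzPowTo_succ_apply κ₁ j l (l + 2 * j) m rfl hm (by omega),
      -- `L₂ (L₁ʲ (L₂ x)) = L₁ʲ (L₂ (L₂ x)) = 0`
      lefschetzOperator_lefschetzPowTo_comm κ₁ κ₂ j (rfl : l + 2 * j = l + 2 * j) (by omega) rfl (by omega), h0,
      map_zero]
    push_cast
    module

end Formal

/-! ## §2 The primitive one-step lift on `X × E` (one smooth projective `X`, one elliptic curve `E`) -/

section OneStep

variable {X : SchemeOver ℂ} {n : ℕ}

/-- `Hⁱ(Spec ℂ (ℂ); ℂ) = 0` for `i ≠ 0`: the complex points of `Spec ℂ` form a one-point space. [cite: HatcherAT2002, §3.1 p. 199] -/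
theorem complexBetti_specOver_eq_zero {i : ℕ} (hi : i ≠ 0) (x : complexBetti (specOver ℂ ℂ) i) : x = 0 := by
  haveI : Subsingleton (ComplexPoints (specOver ℂ ℂ)) := inferInstanceAs (Subsingleton (specOver ℂ ℂ ⟶ specOver ℂ ℂ))
  have hZ : IsZero (complexBetti (specOver ℂ ℂ) i) :=
    Literature.AlgebraicTopology.SingularHomology.singularCochainComplex.isZero_singularCohomology_of_subsingleton' hi
  have h1 : (𝟙 (complexBetti (specOver ℂ ℂ) i) : _ ⟶ _) = 0 := hZ.eq_of_src _ _
  have := congrArg (fun φ : complexBetti (specOver ℂ ℂ) i ⟶ complexBetti (specOver ℂ ℂ) i ↦ φ x) h1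
  simpa using this

/-- On `X × E` with `dim E = 1`: `pr₂^* K_E ∪ (pr₂^* K_E ∪ y) = 0` (`K_E ∪ K_E ∈ H⁴(E(ℂ)) = 0`).
[cite: HatcherAT2002, §3.3 Thm. 3.26(c)] -/
theorem lefschetzOperator_lefschetzOperator_map_snd_eq_zero (E : AbelianVariety ℂ) (hE1 : E.dim = 1)
    (K_E : complexBetti E.X 2) {k l : ℕ} (hl : 2 + k = l) (y : complexBetti (X ⊗ E.X) k) :
    lefschetzOperator (complexBetti.map (snd X E.X) 2 K_E) (rfl : 2 + l = 2 + l)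
      (lefschetzOperator (complexBetti.map (snd X E.X) 2 K_E) hl y) = 0 := by
  haveI : Subsingleton (complexBetti E.X 4) :=
    subsingleton_complexBetti (AbelianVariety.isSmoothProjective_holds (A := E)) (by omega)
  have hKK : cupProduct (rfl : 2 + 2 = 4) K_E K_E = 0 := Subsingleton.elim _ _
  rw [lefschetzOperator_apply, lefschetzOperator_apply,
    ← cupProduct_assoc (rfl : 2 + 2 = 4) hl (show 4 + k = 2 + l by omega) rfl, ← cupProduct_map, hKK, map_zero,
    LinearMap.map_zero₂]

/-- **The lift raises Hodge type by `(1,1)`**: for `Y` smooth projective of dimension `N`, `κ ∈ N¹H²(Y)` and `y` of type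
`(p, q)`, `L_κ y` is of type `(p+1, q+1)` (`κ` is algebraic, hence of type `(1,1)`; the cup product adds Hodge types).
[cite: VoisinHodgeI2002, Rem. 6.27, §7.1.2 and §11.1.2 Prop. 11.20] -/
theorem isOfHodgeType_lefschetzOperator_of_mem_algebraicClasses {Y : SchemeOver ℂ} {N : ℕ} (hY : IsSmoothProjective N Y)
    {κ : complexBetti Y 2} (hκ : κ ∈ algebraicClasses Y 1) {k l : ℕ} (hl : 2 + k = l) {p q : ℕ} {y : complexBetti Y k}
    (hy : IsOfHodgeType N Y k p q y) : IsOfHodgeType N Y l (p + 1) (q + 1) (lefschetzOperator κ hl y) :=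
  isOfHodgeType_lefschetzOperator_of_cupPreservesHodgeType
    (cupPreservesHodgeType_of_multiplicative_deRham
      (fun E _ _ _ ↦ Literature.NumberTheory.Transcendental.exists_deRhamIsoFamily_holds E) hY)
    (isOfHodgeType_of_mem_algebraicClasses_of_isSmoothProjective hY 1 hκ) k l hl p q y hy

/-- Primitive classes pull back to primitive classes along ANY morphism `φ : X' ⟶ X` (for the pulled-back class `φ^*κ` and
the same formal dimension): `Lʳ` commutes with `φ^*`. [cite: VoisinHodgeI2002, §6.2.3 Def. 6.24] -/
theorem map_mem_primitiveClasses {X' : SchemeOver ℂ} (φ : X' ⟶ X) {κ : complexBetti X 2} {N a : ℕ} {x : complexBetti X a}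
    (hx : x ∈ primitiveClasses κ N a) : complexBetti.map φ a x ∈ primitiveClasses (complexBetti.map φ 2 κ) N a :=
  ⟨fun ha ↦ by rw [hx.1 ha, map_zero], fun r m h hr ↦ by rw [← map_lefschetzPowTo, hx.2 r m h hr, map_zero]⟩

variable (E : AbelianVariety ℂ) (η : complexBetti X 2) (K_E : complexBetti E.X 2)

/-- **THE PRIMITIVE ONE-STEP LIFT IS PRIMITIVE.** `X` smooth projective of dimension `n = 2p + (r + 1)`, `E` an abelian
variety of dimension `1`, `η ∈ H²(X)`, `K_E ∈ H²(E)`, `c ∈ P^{2p}(X, η)` (`L_η^{r+2} c = 0`). On `X × E` put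
`θ := pr₁^*η + pr₂^*K_E`, `c̃ := pr₁^*c` and `z := L_{pr₁^*η} c̃ - (r + 1) · L_{pr₂^*K_E} c̃ ∈ H^{2(p+1)}(X × E)`. Then
`z ∈ P^{2(p+1)}(X × E, θ)` in dimension `n + 1`: `L_θ^{r+1} z = L_{pr₁^*η}^{r+2} c̃ = pr₁^*(L_η^{r+2} c) = 0` (§1 with
`(pr₂^*K_E)² = 0`). The weight bookkeeping is the Clebsch–Gordan rule for `V_{r+1} ⊗ V_1 ⊃ V_r` of `𝔰𝔩₂`.
[cite: VoisinHodgeI2002, §6.2.3 Def. 6.24 and Cor. 6.26] [cite: Kleiman1968AlgebraicCycles, §1.4 and Thm. 2.9] -/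
theorem primitiveLift_mem_primitiveClasses (hE1 : E.dim = 1) {p r : ℕ} (hn : 2 * p + (r + 1) = n)
    {c : complexBetti X (2 * p)} (hc : c ∈ primitiveClasses η n (2 * p)) :
    lefschetzOperator (complexBetti.map (fst X E.X) 2 η) (two_add_two_mul p) (complexBetti.map (fst X E.X) (2 * p) c) -
        ((r + 1 : ℕ) : ℂ) • lefschetzOperator (complexBetti.map (snd X E.X) 2 K_E) (two_add_two_mul p)
          (complexBetti.map (fst X E.X) (2 * p) c) ∈
      primitiveClasses (complexBetti.map (fst X E.X) 2 η + complexBetti.map (snd X E.X) 2 K_E) (n + E.dim) (2 * (p + 1)) := by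
  rw [primitiveClasses_eq_ker _ (n + E.dim) (show 2 * (p + 1) ≤ n + E.dim by omega)
    (show 2 * (p + 1) + (r + 1) = n + E.dim + 1 by omega)
    (rfl : 2 * (p + 1) + 2 * (r + 1) = 2 * (p + 1) + 2 * (r + 1)), LinearMap.mem_ker,
    lefschetzPowTo_primitiveLift _ _ (two_add_two_mul p) _
      (lefschetzOperator_lefschetzOperator_map_snd_eq_zero E hE1 K_E (two_add_two_mul p) _) (r + 1) (r + 1) rfl,
    sub_self, zero_smul, add_zero,
    lefschetzPowTo_lefschetzOperator _ (r + 1) (two_add_two_mul p) rfl (by omega : 2 * p + 2 * (r + 1 + 1) = _),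
    ← map_lefschetzPowTo, lefschetzPowTo_eq_zero_of_mem_primitiveClasses hc _ (by omega), map_zero]

/-- The lift is RATIONAL when `η`, `K_E` and `c` are (pull-backs, cup products, `ℚ`-linear combinations).
[cite: HatcherAT2002, §3.1 p. 198 and §3.2 p. 206] [cite: VoisinHodgeI2002, §7.1.2] -/
theorem isRationalClass_primitiveLift (hη : IsRationalClass η) (hKE : IsRationalClass K_E) {p : ℕ}
    {c : complexBetti X (2 * p)} (hc : IsRationalClass c) (r : ℕ) :
    IsRationalClass (lefschetzOperator (complexBetti.map (fst X E.X) 2 η) (two_add_two_mul p)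
        (complexBetti.map (fst X E.X) (2 * p) c) -
      (r : ℂ) • lefschetzOperator (complexBetti.map (snd X E.X) 2 K_E) (two_add_two_mul p)
        (complexBetti.map (fst X E.X) (2 * p) c)) := by
  have h₁ : IsRationalClass (lefschetzOperator (complexBetti.map (fst X E.X) 2 η) (two_add_two_mul p)
      (complexBetti.map (fst X E.X) (2 * p) c)) := by
    rw [lefschetzOperator_apply]; exact (hη.map _).cup _ (hc.map _)
  have h₂ : IsRationalClass (lefschetzOperator (complexBetti.map (snd X E.X) 2 K_E) (two_add_two_mul p)
      (complexBetti.map (fst X E.X) (2 * p) c)) := by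
    rw [lefschetzOperator_apply]; exact (hKE.map _).cup _ (hc.map _)
  simpa [sub_eq_add_neg] using h₁.add (h₂.smul (-(r : ℚ)))

/-- The lift is of HODGE TYPE `(p+1, p+1)` when `c` is of type `(p, p)` and `η`, `K_E` are supported on divisors (pull-backs
preserve Hodge types; an algebraic degree-`2` class is of type `(1,1)` and `∪` adds types). [cite: VoisinHodgeI2002, Rem. 6.27,
§7.1.2, §7.3.2 and §11.1.2 Prop. 11.20] -/
theorem isOfHodgeType_primitiveLift (hX : IsSmoothProjective n X) (hη : η ∈ algebraicClasses X 1)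
    (hKE : K_E ∈ algebraicClasses E.X 1) {p : ℕ} {c : complexBetti X (2 * p)} (hc : IsOfHodgeType n X (2 * p) p p c) (r : ℕ) :
    IsOfHodgeType (n + E.dim) (X ⊗ E.X) (2 * (p + 1)) (p + 1) (p + 1)
      (lefschetzOperator (complexBetti.map (fst X E.X) 2 η) (two_add_two_mul p) (complexBetti.map (fst X E.X) (2 * p) c) -
        (r : ℂ) • lefschetzOperator (complexBetti.map (snd X E.X) 2 K_E) (two_add_two_mul p)
          (complexBetti.map (fst X E.X) (2 * p) c)) := by
  have hE : IsSmoothProjective E.dim E.X := AbelianVariety.isSmoothProjective_holds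
  have hY : IsSmoothProjective (n + E.dim) (X ⊗ E.X) := IsSmoothProjective.tensor_holds hX hE
  have hc' : IsOfHodgeType (n + E.dim) (X ⊗ E.X) (2 * p) p p (complexBetti.map (fst X E.X) (2 * p) c) :=
    hc.map_of_isSmoothProjective hY hX (fst X E.X)
  exact (isOfHodgeType_lefschetzOperator_of_mem_algebraicClasses hY (map_fst_mem_supportedClasses hX hE hη)
    (two_add_two_mul p) hc').sub hY ((isOfHodgeType_lefschetzOperator_of_mem_algebraicClasses hY
      (map_snd_mem_supportedClasses hX hE hKE) (two_add_two_mul p) hc').smul _)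

/-- The lift is ALGEBRAIC when `c` is (`η`, `K_E` supported on divisors): the flat `pr₁^*` and the Lefschetz operators of
divisor classes move algebraic classes. [cite: VoisinHodgeII2003, §9.2.4 Prop. 9.20 and proof of Prop. 9.21 (i)]
[cite: Fulton1998, §19.2 Cor. 19.2] -/
theorem primitiveLift_mem_algebraicClasses (hX : IsSmoothProjective n X) (hη : η ∈ algebraicClasses X 1)
    (hKE : K_E ∈ algebraicClasses E.X 1) {p : ℕ} {c : complexBetti X (2 * p)} (hc : c ∈ algebraicClasses X p) (r : ℕ) :
    lefschetzOperator (complexBetti.map (fst X E.X) 2 η) (two_add_two_mul p) (complexBetti.map (fst X E.X) (2 * p) c) -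
        (r : ℂ) • lefschetzOperator (complexBetti.map (snd X E.X) 2 K_E) (two_add_two_mul p)
          (complexBetti.map (fst X E.X) (2 * p) c) ∈ algebraicClasses (X ⊗ E.X) (p + 1) := by
  have hE : IsSmoothProjective E.dim E.X := AbelianVariety.isSmoothProjective_holds
  have hY : IsSmoothProjective (n + E.dim) (X ⊗ E.X) := IsSmoothProjective.tensor_holds hX hE
  have hc' : complexBetti.map (fst X E.X) (2 * p) c ∈ algebraicClasses (X ⊗ E.X) p := map_fst_mem_supportedClasses hX hE hc
  exact Submodule.sub_mem _
    (lefschetzOperator_mem_algebraicClasses_of_mem hY (map_fst_mem_supportedClasses hX hE hη) p hc')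
    (Submodule.smul_mem _ _ (lefschetzOperator_mem_algebraicClasses_of_mem hY (map_snd_mem_supportedClasses hX hE hKE) p hc'))

/-- `φ^*(L_κ y) = L_{φ^*κ}(φ^* y)`: the Lefschetz operator is natural for pull-backs (the cup product is).
[cite: HatcherAT2002, §3.2 Prop. 3.10] -/
theorem map_lefschetzOperator {X' : SchemeOver ℂ} (φ : X' ⟶ X) (κ : complexBetti X 2) {k l : ℕ} (h : 2 + k = l)
    (y : complexBetti X k) :
    complexBetti.map φ l (lefschetzOperator κ h y) = lefschetzOperator (complexBetti.map φ 2 κ) h (complexBetti.map φ k y) :=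
  Literature.Geometry.Kaehler.lefschetzOperator_map _ κ h y

/-- **DESCENT OF ALGEBRAICITY FROM THE LIFT** (the abelian input). `X` smooth projective of dimension `n = 2p + (r + 1)`
isomorphic to an abelian variety, `η` a polarisation class, `E` any abelian variety, `K_E ∈ H²(E)`. If the lift
`z = L_{pr₁^*η} pr₁^*c - s · L_{pr₂^*K_E} pr₁^*c` is algebraic on `X × E` then `c` is algebraic on `X`: restrict `z` to the
slice `X ≅ X × {t}` — a fibre of the CONSTANT family `X × E ⟶ E` over the smooth projective irreducible `E`, where the
tree's specialisation theorem `map_fiberι_mem_algebraicClasses` applies —; there `pr₂^*K_E` restricts through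
`H²(Spec ℂ (ℂ)) = 0`, so `z|_{X × {t}} = L_η c` is algebraic, hence `L_η^{r+1} c` is, and `A(X, η)` — Lieberman's theorem for
the abelian variety `X` — descends `L_η^{r+1} : H^{2p} ⥲ H^{2n-2p}`. [cite: Lieberman1968, main theorem]
[cite: Kleiman1968AlgebraicCycles, §2 Thm. 2A11] [cite: Fulton1998, §10.1 Cor. 10.1 and Example 10.1.2]
[cite: CharlesSchnell2014Notes, Prop. 11.3.11 (proof)] [cite: Hartshorne1977, II.3 (p. 89)] -/
theorem mem_algebraicClasses_of_primitiveLift_mem (hX : IsSmoothProjective n X) {A : AbelianVariety ℂ} (hA : A.dim = n)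
    (eA : A.X ≅ X) (hη : IsPolarizationClass n X η) {p r : ℕ} (hn : 2 * p + (r + 1) = n) {c : complexBetti X (2 * p)} (s : ℂ)
    (hz : lefschetzOperator (complexBetti.map (fst X E.X) 2 η) (two_add_two_mul p) (complexBetti.map (fst X E.X) (2 * p) c) -
        s • lefschetzOperator (complexBetti.map (snd X E.X) 2 K_E) (two_add_two_mul p)
          (complexBetti.map (fst X E.X) (2 * p) c) ∈ algebraicClasses (X ⊗ E.X) (p + 1)) :
    c ∈ algebraicClasses X p := by
  have hE : IsSmoothProjective E.dim E.X := AbelianVariety.isSmoothProjective_holds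
  haveI : IrreducibleSpace E.X.left := hE.irreducibleSpace
  haveI := hE.smoothOfRelativeDimension
  haveI : AlgebraicGeometry.Smooth E.X.hom := SmoothOfRelativeDimension.smooth E.dim E.X.hom
  obtain ⟨t⟩ := hE.nonempty_algPoints ℂ
  -- restrict to the fibre of the constant family `X × E ⟶ E` over `t`, then to `X` along the slice isomorphism
  have h₁ := map_fiberι_mem_algebraicClasses (snd X E.X) (isSmoothProjectiveFamily_snd hX E.X)
    (IsQuasiProjectiveOver.of_isProjectiveOver hE.isProjectiveOver) hz t
  have h₂ := map_mem_algebraicClasses_of_isIso (sliceFiberIso X t).hom h₁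
  rw [← complexBetti.map_comp_apply'] at h₂
  -- the slice followed by the two projections
  have hfst : ∀ {i : ℕ} (y : complexBetti X i), complexBetti.map ((sliceFiberIso X t).hom ≫ fiberι (snd X E.X) t) i
      (complexBetti.map (fst X E.X) i y) = y := fun y ↦ by
    rw [← complexBetti.map_comp_apply', Category.assoc, sliceFiberIso_hom_fiberι_fst, complexBetti.map_id]; rfl
  have hsnd : complexBetti.map ((sliceFiberIso X t).hom ≫ fiberι (snd X E.X) t) 2 (complexBetti.map (snd X E.X) 2 K_E) = 0 := by
    rw [← complexBetti.map_comp_apply', Category.assoc, sliceFiberIso_hom_fiberι_snd, complexBetti.map_comp_apply',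
      complexBetti_specOver_eq_zero two_ne_zero (complexBetti.map t 2 K_E), map_zero]
  rw [map_sub, map_smul, map_lefschetzOperator, map_lefschetzOperator, hfst, hfst, hsnd, lefschetzOperator_apply (0 : complexBetti X 2),
    LinearMap.map_zero₂, smul_zero, sub_zero] at h₂
  -- `L_η c` is algebraic; push up to `L_η^{r+1} c` and descend by `A(X, η)` (Lieberman)
  obtain ⟨Λ, hΛ⟩ := hη.exists_hardLefschetzNFold hX
  subst hΛ
  have h₃ := Λ.L_mem_algebraicClasses_of_mem r (p + 1) (by omega : 2 * (p + 1) + 2 * r = 2 * (p + 1 + r)) h₂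
  rw [HardLefschetzNFold.L, lefschetzPowTo_lefschetzOperator _ r (two_add_two_mul p) _
    (by omega : 2 * p + 2 * (r + 1) = 2 * (p + 1 + r))] at h₃
  exact mem_algebraicClasses_of_lefschetzPowTo_mem (standardConjectureA_of_iso_abelianVariety hX hA eA hη) hn _
    (by omega : p + (r + 1) = p + 1 + r) c h₃

end OneStep

/-! ## Audit: fact-free (closures are the three standard axioms; no named fact, no `HC_CM`) -/

#print axioms Summit.HodgeConjecture.HodgeConjecture.Ring2.Binders.lefschetzPowTo_primitiveLift
#print axioms Summit.HodgeConjecture.HodgeConjecture.Ring2.Binders.primitiveLift_mem_primitiveClasses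
#print axioms Summit.HodgeConjecture.HodgeConjecture.Ring2.Binders.mem_algebraicClasses_of_primitiveLift_mem

end Summit.HodgeConjecture.HodgeConjecture.Ring2.Binders

end
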